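/-
Origin: expansion seat `prover-pub-hodgecm-mc-binder-1-g16-0`, handover #R109 2026-08-20T20:24:29Z md5 4d4bceaafb2d (219 l.; NEW additive MODEL leaf; imports #R108 HodgeCM.Model.TowerLevel + Mathlib.Algebra.Colimit.Module + Mathlib.RepresentationTheory.Basic; install after #R108; drop-alone below it; NAME LIST (theorems for audit: HodgeCM.Model.TowerCarrier.act_mul · HodgeCM.Model.TowerCarrier.act_ofLevel_of_mem · HodgeCM.Model.TowerCarrier.of_smul_ofLevel_of_mem); all decls: HodgeCM.TLvl · HodgeCM.TLvl.instPreorder · HodgeCM.TLvl.le_def · HodgeCM.TLvl.instIsDirected · HodgeCM.TLvl.instNonempty · HodgeCM.TLvl.mk · HodgeCM.TLvl.conj · HodgeCM.TLvl.conj_mono · HodgeCM.Model.TowerCarrier.HK · HodgeCM.Model.TowerCarrier.towerSystem · HodgeCM.Model.TowerCarrier.directedSystem · HodgeCM.Model.TowerCarrier.Tower · HodgeCM.Model.TowerCarrier.ofLevel · HodgeCM.Model.TowerCarrier.ofLevel_restrictLevel · HodgeCM.Model.TowerCarrier.ofLevel_castLevel · HodgeCM.Model.TowerCarrier.exists_ofLevel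 · HodgeCM.Model.TowerCarrier.act · HodgeCM.Model.TowerCarrier.act_ofLevel · HodgeCM.Model.TowerCarrier.act_ofLevel_of_mem · HodgeCM.Model.TowerCarrier.act_one · HodgeCM.Model.TowerCarrier.act_mul · HodgeCM.Model.TowerCarrier.towerRep · HodgeCM.Model.TowerCarrier.towerRep_apply · HodgeCM.Model.TowerCarrier.TowerModule · HodgeCM.Model.TowerCarrier.ofLevelM · HodgeCM.Model.TowerCarrier.of_smul · HodgeCM.Model.TowerCarrier.of_smul_ofLevel_of_mem · HodgeCM.Model.TowerCarrier.towerRep_ofLevel_of_mem) (`HOME/mc/pub-hodgecm-mc-binder-1-g16/stage62/HodgeCM/Model/TowerCarrier.lean`, md5 4d4bceaafb2d, 219 lines);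
landed by the second packager p2 gen 13 (p2-g13) in gate run 62 as `HodgeCM/Model/TowerCarrier.lean` (verbatim).
-/
/-
Copyright (c) 2026 the pub-hodgecm formalisation cell (harness21).  New file, not vendored.
Origin: session prover-pub-hodgecm-mc-binder-1-g16-0 (unit pub-hodgecm-mc-binder-1-g16, BINDER PROVER gen 16 of lineage mc-binder-1;
content lane (J-Liu-Θ), (J3) design memo `HOME/mc/pub-hodgecm-mc-axioms-1-g15/J3-DESIGN.md` §3 + WORD TO binder-1 (STATUS 2026-08-20T19:56:33Z):
HECKE-TOWER — the tower `H = colim_K H_K` as a `ℂ[U(V)(𝔸_f)]`-module), 2026-08-20.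
-/
import Summits.HodgeConjecture.HodgeCM.Model.TowerLevel_2
import Mathlib.Algebra.Colimit.Module
import Mathlib.RepresentationTheory.Basic

/-!
# The tower carrier `H = colim_K H¹(X_K(ℂ); ℂ)` and its `ℂ[U(V)(𝔸_{L₀,f})]`-module structure

For the model universe `U = universeOf hHD hI hU h₃` and a hermitian space `(L, ι₁, V)`:

* `TLvl V` — the index type of the tower: the levels `Γ = (Γ, K)` of `V` lying below a conjugate of `K_f(3)`
  (`Level.BelowConjThree`, #R106), PREORDERED BY REVERSE INCLUSION OF `K` (`i ≤ j ↔ j.1 ≤ i.1`), directed (meets) and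
  non-empty (`Level.three`);
* `towerSystem` — the directed system `K ↦ H_K = towerLevel … K` (#R108) with the pull-backs `restrictLevel` as transition
  maps (`DirectedSystem`: `restrictLevel_refl/_trans`);
* `Tower … V := Module.DirectLimit` of it — Liu's `H¹_{B,ι₁}(A_∞, ℂ) = colim_K H¹(X_K(ℂ); ℂ)` BUILT from the connected components
  of the `X_K(ℂ)`; `ofLevel Γ hΓ : H_K →ₗ[ℂ] Tower`;
* `act g : Tower →ₗ[ℂ] Tower` — the action of `g ∈ U(V)(𝔸_f)` (`DirectLimit.lift` of `ofLevel (Γ.conj g) ∘ translate g`,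
  compatible with the transitions by `translate_restrictLevel`), with `act_ofLevel`, `act_one`, `act_mul` (from `translate_one/_mul`
  and `ofLevel_castLevel : ofLevel Γ₂ (castLevel e c) = ofLevel Γ₁ c`), packaged as
  **`towerRep … V : Representation ℂ V.adelicFin (Tower … V)`**; the `ℂ[U(V)(𝔸_f)]`-MODULE is `(towerRep … V).asModule`
  (Mathlib: `Module (MonoidAlgebra ℂ _)`, `IsScalarTower ℂ _ _`), `of_smul : MonoidAlgebra.of ℂ _ g • x = act g x`;
* **`act_ofLevel_of_mem` / `of_smul_ofLevel_of_mem`: the image of `H_K` consists of `K`-fixed vectors** (`translate_of_mem`) —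
  the `hIso` input of the (J3) junction takes its `K`-fixed vector here.

The identity-component restriction `res Γ : Tower →ₗ H¹(P_Γ; ℂ)` (total) needs the injectivity of the transition maps (finite
covers; #R95/#R96 transfer) and is the next leaf; at finite level it is `TowerLevel.res`.
-/

noncomputable section

open scoped Matrix
open Function Set
open NumberField
open Literature.AlgebraicGeometry.Motives
open Literature.AlgebraicGeometry.ShimuraVarieties
open Literature.AlgebraicGeometry.HodgeTheory
open Literature.NumberTheory.Automorphic
open Literature.NumberTheory.Automorphic.PicardCM
open Literature.NumberTheory.Transcendental (Arapura2012_Cor_15_4_6)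

namespace HodgeCM

/-! ## 1. The index type of the tower -/

/-- The levels of `V` below a conjugate of the principal level `3` — the index type of the tower. -/
def TLvl {L : CMField} {ι₁ : L →+* ℂ} (V : HermSpace3 L ι₁) : Type := {Γ : Level V // Γ.BelowConjThree}

namespace TLvl

variable {L : CMField} {ι₁ : L →+* ℂ} {V : HermSpace3 L ι₁}

/-- **The tower order: REVERSE inclusion of the compact opens** (`i ≤ j` iff `K_j ≤ K_i`, i.e. `X_{K_j} → X_{K_i}`). -/
instance instPreorder : Preorder (TLvl V) where
  le i j := j.1 ≤ i.1
  le_refl i := le_refl i.1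
  le_trans i j k hij hjk := le_trans hjk hij

/-- (Ported verbatim from the HodgeCMPerL package; no docstring in the source.) -/
theorem le_def {i j : TLvl V} : i ≤ j ↔ j.1 ≤ i.1 := Iff.rfl

/-- The tower order is directed (common refinement `K_i ∩ K_j`). -/
instance instIsDirected : IsDirected (TLvl V) (· ≤ ·) :=
  ⟨fun i j ↦ ⟨⟨i.1 ⊓ j.1, i.2.of_le inf_le_left⟩, (inf_le_left : i.1 ⊓ j.1 ≤ i.1), (inf_le_right : i.1 ⊓ j.1 ≤ j.1)⟩⟩

/-- (Ported verbatim from the HodgeCMPerL package; no docstring in the source.) -/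
instance instNonempty : Nonempty (TLvl V) := ⟨⟨Level.three V, Level.BelowConjThree.three⟩⟩

/-- (Ported verbatim from the HodgeCMPerL package; no docstring in the source.) -/
instance instDecidableEq : DecidableEq (TLvl V) := Classical.decEq _

/-- The level `Γ` with its proof, as an index. -/
abbrev mk (Γ : Level V) (hΓ : Γ.BelowConjThree) : TLvl V := ⟨Γ, hΓ⟩

/-- Conjugating an index: `(Γ, K) ↦ (U(L₀) ∩ gKg⁻¹, gKg⁻¹)`. -/
abbrev conj (i : TLvl V) (g : V.adelicFin) : TLvl V := ⟨i.1.conj g i.2, i.2.conj g⟩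

/-- (Ported verbatim from the HodgeCMPerL package; no docstring in the source.) -/
theorem conj_mono {i j : TLvl V} (h : i ≤ j) (g : V.adelicFin) : i.conj g ≤ j.conj g :=
  Level.conj_mono (le_def.mp h) g i.2 j.2

end TLvl

namespace Model.TowerCarrier

open HodgeCM.Model.LevelTranslate HodgeCM.Model.TowerLevel

variable (hHD : exists_isReal_hodgeModel) (hI : hodgePQ_independent_of_hodgeModel)
  (hU : BallQuotientUniformisedDatum) (h₃ : CMAbelianVarietyRealised) (hA : Arapura2012_Cor_15_4_6)
variable {L : CMField} {ι₁ : L →+* ℂ}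

/-! ## 2. The directed system `K ↦ H_K` and its direct limit -/

/-- `H_{K_i} = towerLevel` at the index `i`. -/
abbrev HK (V : HermSpace3 L ι₁) (i : TLvl V) : Type := ↥(towerLevel hHD hI hU h₃ hA i.1 i.2)

/-- The transition maps `H_{K_i} → H_{K_j}` (`K_j ≤ K_i`): pull-back along the component coverings. -/
def towerSystem (V : HermSpace3 L ι₁) (i j : TLvl V) (hij : i ≤ j) : HK hHD hI hU h₃ hA V i →ₗ[ℂ] HK hHD hI hU h₃ hA V j :=
  restrictLevel hHD hI hU h₃ hA (TLvl.le_def.mp hij) i.2 j.2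

/-- (Ported verbatim from the HodgeCMPerL package; no docstring in the source.) -/
instance directedSystem (V : HermSpace3 L ι₁) :
    DirectedSystem (HK hHD hI hU h₃ hA V) (fun i j hij ↦ towerSystem hHD hI hU h₃ hA V i j hij) where
  map_self i x := restrictLevel_refl hHD hI hU h₃ hA i.2 x
  map_map k j i hij hjk x := restrictLevel_trans hHD hI hU h₃ hA (TLvl.le_def.mp hij) (TLvl.le_def.mp hjk) i.2 j.2 k.2 x

/-- **The tower `H = colim_K H¹(X_K(ℂ); ℂ)`** of `(L, ι₁, V)` on the model universe. -/
abbrev Tower (V : HermSpace3 L ι₁) : Type :=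
  Module.DirectLimit (HK hHD hI hU h₃ hA V) (towerSystem hHD hI hU h₃ hA V)

variable {V : HermSpace3 L ι₁}

/-- `H_K → H`. -/
abbrev ofLevel (Γ : Level V) (hΓ : Γ.BelowConjThree) : ↥(towerLevel hHD hI hU h₃ hA Γ hΓ) →ₗ[ℂ] Tower hHD hI hU h₃ hA V :=
  Module.DirectLimit.of ℂ (TLvl V) (HK hHD hI hU h₃ hA V) (towerSystem hHD hI hU h₃ hA V) (TLvl.mk Γ hΓ)

/-- Compatibility with the transitions: `ofLevel Γ' (restrictLevel c) = ofLevel Γ c` (`Γ' ≤ Γ`). -/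
theorem ofLevel_restrictLevel {Γ Γ' : Level V} (hle : Γ' ≤ Γ) (hΓ : Γ.BelowConjThree) (hΓ' : Γ'.BelowConjThree)
    (c : towerLevel hHD hI hU h₃ hA Γ hΓ) :
    ofLevel hHD hI hU h₃ hA Γ' hΓ' (restrictLevel hHD hI hU h₃ hA hle hΓ hΓ' c) = ofLevel hHD hI hU h₃ hA Γ hΓ c :=
  Module.DirectLimit.of_f (i := TLvl.mk Γ hΓ) (j := TLvl.mk Γ' hΓ') (hij := hle)

/-- Crossing an equality of levels is invisible in the tower: `ofLevel Γ₂ (castLevel e c) = ofLevel Γ₁ c`. -/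
theorem ofLevel_castLevel {Γ₁ Γ₂ : Level V} (e : Γ₁ = Γ₂) (hΓ₁ : Γ₁.BelowConjThree) (hΓ₂ : Γ₂.BelowConjThree)
    (c : towerLevel hHD hI hU h₃ hA Γ₁ hΓ₁) :
    ofLevel hHD hI hU h₃ hA Γ₂ hΓ₂ (castLevel hHD hI hU h₃ hA e hΓ₁ hΓ₂ c) = ofLevel hHD hI hU h₃ hA Γ₁ hΓ₁ c :=
  ofLevel_restrictLevel hHD hI hU h₃ hA e.symm.le hΓ₁ hΓ₂ c

/-- Every element of the tower comes from some level. -/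
theorem exists_ofLevel (x : Tower hHD hI hU h₃ hA V) :
    ∃ (Γ : Level V) (hΓ : Γ.BelowConjThree) (c : towerLevel hHD hI hU h₃ hA Γ hΓ), ofLevel hHD hI hU h₃ hA Γ hΓ c = x := by
  obtain ⟨i, c, rfl⟩ := Module.DirectLimit.exists_of x
  exact ⟨i.1, i.2, c, rfl⟩

/-! ## 3. The action of `U(V)(𝔸_f)` -/

/-- **`g ∈ U(V)(𝔸_f)` acting on the tower**: on `H_K`, translate to `H_{gKg⁻¹}` and map to the limit. -/
def act (g : V.adelicFin) : Tower hHD hI hU h₃ hA V →ₗ[ℂ] Tower hHD hI hU h₃ hA V :=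
  Module.DirectLimit.lift ℂ (TLvl V) (HK hHD hI hU h₃ hA V) (towerSystem hHD hI hU h₃ hA V)
    (fun i ↦ ofLevel hHD hI hU h₃ hA (i.1.conj g i.2) (i.2.conj g) ∘ₗ TowerLevel.translate hHD hI hU h₃ hA i.2 g)
    (fun i j hij c ↦ by
      change ofLevel hHD hI hU h₃ hA _ _ (TowerLevel.translate hHD hI hU h₃ hA j.2 g (restrictLevel hHD hI hU h₃ hA _ i.2 j.2 c)) =
        ofLevel hHD hI hU h₃ hA _ _ (TowerLevel.translate hHD hI hU h₃ hA i.2 g c)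
      rw [translate_restrictLevel, ofLevel_restrictLevel])

/-- `act g (ofLevel Γ c) = ofLevel (Γ.conj g) (translate g c)`. -/
@[simp] theorem act_ofLevel (g : V.adelicFin) {Γ : Level V} (hΓ : Γ.BelowConjThree) (c : towerLevel hHD hI hU h₃ hA Γ hΓ) :
    act hHD hI hU h₃ hA g (ofLevel hHD hI hU h₃ hA Γ hΓ c) =
      ofLevel hHD hI hU h₃ hA (Γ.conj g hΓ) (hΓ.conj g) (TowerLevel.translate hHD hI hU h₃ hA hΓ g c) :=
  Module.DirectLimit.lift_of _ _ _

/-- **`K` acts trivially on the image of `H_K`.** -/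
theorem act_ofLevel_of_mem {Γ : Level V} (hΓ : Γ.BelowConjThree) {k : V.adelicFin} (hk : k ∈ Γ.K)
    (c : towerLevel hHD hI hU h₃ hA Γ hΓ) :
    act hHD hI hU h₃ hA k (ofLevel hHD hI hU h₃ hA Γ hΓ c) = ofLevel hHD hI hU h₃ hA Γ hΓ c := by
  rw [act_ofLevel, ← ofLevel_castLevel hHD hI hU h₃ hA (Level.conj_of_mem Γ hk hΓ) (hΓ.conj k) hΓ,
    translate_of_mem hHD hI hU h₃ hA hΓ hk]

/-- `act 1 = id`. -/
theorem act_one : act hHD hI hU h₃ hA (1 : V.adelicFin) = LinearMap.id := by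
  refine Module.DirectLimit.hom_ext fun i ↦ LinearMap.ext fun c ↦ ?_
  rw [LinearMap.comp_apply, LinearMap.comp_apply, LinearMap.id_apply]
  change act hHD hI hU h₃ hA 1 (ofLevel hHD hI hU h₃ hA i.1 i.2 c) = ofLevel hHD hI hU h₃ hA i.1 i.2 c
  rw [act_ofLevel, ← ofLevel_castLevel hHD hI hU h₃ hA (Level.conj_one i.1 i.2) (i.2.conj 1) i.2, translate_one]

/-- `act (g g') = act g ∘ act g'`. -/
theorem act_mul (g g' : V.adelicFin) :
    act hHD hI hU h₃ hA (g * g') = act hHD hI hU h₃ hA g ∘ₗ act hHD hI hU h₃ hA g' := by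
  refine Module.DirectLimit.hom_ext fun i ↦ LinearMap.ext fun c ↦ ?_
  rw [LinearMap.comp_apply, LinearMap.comp_apply, LinearMap.comp_apply]
  change act hHD hI hU h₃ hA (g * g') (ofLevel hHD hI hU h₃ hA i.1 i.2 c) =
    act hHD hI hU h₃ hA g (act hHD hI hU h₃ hA g' (ofLevel hHD hI hU h₃ hA i.1 i.2 c))
  rw [act_ofLevel, act_ofLevel, act_ofLevel,
    ← ofLevel_castLevel hHD hI hU h₃ hA (Level.conj_mul i.1 g g' i.2) (i.2.conj (g * g')) ((i.2.conj g').conj g),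
    translate_mul]

/-- **The tower as a representation of `U(V)(𝔸_{L₀,f})`.** -/
def towerRep (V : HermSpace3 L ι₁) : Representation ℂ V.adelicFin (Tower hHD hI hU h₃ hA V) where
  toFun := act hHD hI hU h₃ hA
  map_one' := by rw [act_one]; rfl
  map_mul' g g' := by rw [act_mul]; rfl

/-- (Ported verbatim from the HodgeCMPerL package; no docstring in the source.) -/
@[simp] theorem towerRep_apply (g : V.adelicFin) : towerRep hHD hI hU h₃ hA V g = act hHD hI hU h₃ hA g := rfl

/-! ## 4. The `ℂ[U(V)(𝔸_f)]`-module -/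

/-- **Liu's `H¹_{B,ι₁}(A_∞, ℂ)` as a `ℂ[U(V)(𝔸_{L₀,f})]`-MODULE**: the tower with the module structure of its representation
(`Representation.asModule`; as a type this IS `Tower … V`). -/
abbrev TowerModule (V : HermSpace3 L ι₁) : Type := (towerRep hHD hI hU h₃ hA V).asModule

/-- `H_K → H` with values in the `ℂ[U(V)(𝔸_f)]`-module (same map as `ofLevel`, codomain the module synonym). -/
abbrev ofLevelM (Γ : Level V) (hΓ : Γ.BelowConjThree) :
    ↥(towerLevel hHD hI hU h₃ hA Γ hΓ) →ₗ[ℂ] TowerModule hHD hI hU h₃ hA V :=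
  ofLevel hHD hI hU h₃ hA Γ hΓ

/-- The group element `g`, as `MonoidAlgebra.of ℂ _ g`, acts by `act g`. -/
theorem of_smul (g : V.adelicFin) (x : TowerModule hHD hI hU h₃ hA V) :
    MonoidAlgebra.of ℂ V.adelicFin g • x = act hHD hI hU h₃ hA g x := by
  rw [MonoidAlgebra.of_apply, Representation.single_smul, one_smul]
  rfl

/-- **The image of `H_K` in `H` consists of `K`-fixed vectors**: `of k • ofLevel c = ofLevel c` for `k ∈ K`. -/
theorem of_smul_ofLevel_of_mem {Γ : Level V} (hΓ : Γ.BelowConjThree) {k : V.adelicFin} (hk : k ∈ Γ.K)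
    (c : towerLevel hHD hI hU h₃ hA Γ hΓ) :
    MonoidAlgebra.of ℂ V.adelicFin k • ofLevelM hHD hI hU h₃ hA Γ hΓ c = ofLevelM hHD hI hU h₃ hA Γ hΓ c := by
  rw [of_smul]
  exact act_ofLevel_of_mem hHD hI hU h₃ hA hΓ hk c

/-- `K`-fixedness of the image of `H_K`, representation form. -/
theorem towerRep_ofLevel_of_mem {Γ : Level V} (hΓ : Γ.BelowConjThree) {k : V.adelicFin} (hk : k ∈ Γ.K)
    (c : towerLevel hHD hI hU h₃ hA Γ hΓ) :
    towerRep hHD hI hU h₃ hA V k (ofLevel hHD hI hU h₃ hA Γ hΓ c) = ofLevel hHD hI hU h₃ hA Γ hΓ c :=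
  act_ofLevel_of_mem hHD hI hU h₃ hA hΓ hk c

end Model.TowerCarrier

end HodgeCM

end
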